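import Literature.AnabelianGeometry.AbsoluteAnabelian.AbsTopIProp23GFGAffineModelExtension
import Literature.AnabelianGeometry.AbsoluteAnabelian.AbsTopIAlmostProSigmaBridge
import Literature.AnabelianGeometry.AbsoluteAnabelian.NFGaloisTFGNormalCorollaries
import Literature.AnabelianGeometry.AbsoluteAnabelian.AbsTopIThm26vHolds
import HarnessLib

/-!
# [AbsAnab] Lemma 1.3.1 and Lemma 1.3.8 AT THE [AbsTopI] Def 2.1 (i) GFG CONSTRUCTION

S. Mochizuki, *The absolute anabelian geometry of hyperbolic curves* (2004) [AbsAnab], Lemma 1.3.1 p. 15 ("the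
profinite groups `Δ_X`, `Π_X` are slim") and Lemma 1.3.8 p. 18 (an isomorphism `Π_{(X₁)_{K₁}} ⥲ Π_{(X₂)_{K₂}}`
"is compatible with the quotients `Π ↠ G_{Kᵢ}`", i.e. carries `Δ₁` onto `Δ₂`; "follows formally from Lemmas 1.1.4,
1.1.5"); S. Mochizuki, *Topics in Absolute Anabelian Geometry I* (2012) [AbsTopI], Def 2.1 (i) p. 17 (the
"(almost pro-`Σ`) GFG-type" quotient `Δ_X` of a surface group relative to an open subgroup), Thm 2.6 (iv)/(v)/(vi)
pp. 22–24.

abc-iut cell, seat abc-iut-w6-d071 (gen 3), row «ABSANAB-LEM13-GFG» (DAG nodes AbsAnab:Lem1.3.1 / AbsAnab:Lem1.3.8,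
layer L4; typed by abc-iut-L4-t4 as the predicates `FundamentalExtension.GeomAndArithSlim` (FACT-LIST F-0004) and
`FundamentalExtension.PreservesGeom` (F-0007), `AbsAnabFundamentalGroups.lean`).  PROOF-ONLY compositions of landed
theorems — no definition, no named fact, nothing restated.  The carrier is the GENUINE group-theoretic datum of
[AbsTopI] Def 2.1 (i): `Δ = E.geom` presented as the maximal pro-`Σ` quotient of a hyperbolic surface group
(`Γ ≅ S_g`, `g ≥ 2`, proper case: abc-iut-w6-d030 `GFGSurfaceModel`; `Γ` free of rank `≥ 2` / `Γ_{g,k+1}`, affine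
case: abc-iut-w6-d071 `GFGAffineModel`) relative to an open subgroup `U` of a pro-`Σ′` completion, `Σ ⊆ Σ′`,
`Σ` containing a prime — exactly the data on which the L4 lead's count of AbsTopI:Prop2.3(i) rests (13:01:21Z).

* §1 **Lemma 1.3.1** (`GeomAndArithSlim`: `Δ` AND `Π` slim) at the construction, MLF and NF bases, proper /
  affine / every hyperbolic `(g, k+1)`: `MLFBase.geomAndArithSlim_gfg`, `NFBase.geomAndArithSlim_gfg`,
  `…_gfg_affine`, `…_gfg_puncturedSurfaceGroup` — `Δ` slim by Prop 2.3 (i) at the construction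
  (`geomSlimElastic_gfg[_affine|_puncturedSurfaceGroup]`, p440871 / p443488), `Π` slim by abc-iut-L4-t4's
  `MLFBase.geomAndArithSlim` / `NFBase.geomAndArithSlim` (`G_k`, `G_F` slim: [AbsAnab] Thm 1.1.1 (ii), PROVED).
* §2 **Lemma 1.3.8** (`PreservesGeom`): (a) NF bases, ANY `Σ` — generic `NFBase.preservesGeom_of_geomTFG` (both
  `Δ` t.f.g. ⇒ every `α : Π_E ⥲ Π_F` preserves `Δ`; [AbsAnab] Lemma 1.1.4 (i) via abc-iut's unconditional
  `AbsTopII.rmk_3_3_2_NF_holds`, [AbsAnab] Thm 1.1.2 PROVED) and its instances with `E` at the construction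
  (`NFBase.preservesGeom_gfg`, `…_gfg_puncturedSurfaceGroup`); (b) MLF bases, `Σ ⊊ 𝔓𝔯𝔦𝔪𝔢𝔰` — via [AbsTopI]
  Thm 2.6 (iv) (`MLFBase.preservesGeom_of_isAlmostPro`, p444875; the construction IS almost pro-`Σ`,
  `GFGSurfaceModel.isAlmostPro`): `MLFBase.preservesGeom_gfg_of_isAlmostPro[_puncturedSurfaceGroup]` — outright;
  (c) MLF bases, `Σ = 𝔓𝔯𝔦𝔪𝔢𝔰` (the literal profinite case of [AbsAnab]) — `MLFBase.preservesGeom_gfg_of_starCondition`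
  MODULO exactly print's own [AbsAnab] Lemma 1.1.4 (ii) inputs BY NAME: splitting over an open subgroup (F-0011
  `SplitsOverOpenSubgroup`) and (∗) (F-0012 `StarCondition`; Lemma 1.1.5 = the weight input, FOUNDATIONS boundary).

HONEST SCOPE: `Δ` t.f.g. / slim / almost pro-`Σ` are THEOREMS at the construction; the identification of an
étale `π₁` with this datum is the campaign's FOUNDATIONS boundary, as for every [AbsTopI]/[AbsAnab] row.  Classical,
refereed pre-IUT material; OUR kernel check; nothing here bears on the disputed [IUTchIII] Cor. 3.12; no side taken.
-/

noncomputable section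

open Topology

namespace Literature.AnabelianGeometry.AbsoluteAnabelian

namespace FundamentalExtension

open Literature.AlgebraicGeometry.Frobenioids (IsSlimGroup)
open Literature.AnabelianGeometry.SemiGraphs.PSCDatum (IsMaxProSigmaQuotient)
open Literature.AnabelianGeometry.SemiGraphs.SemiGraphOfAnabelioids
open Literature.AnabelianGeometry.SemiGraphs.SemiGraphOfAnabelioids.IsProSigmaCompletion
open Literature.GroupTheory.CombinatorialGroupTheory
open Literature.GroupTheory.ProfiniteSubquotients
open Literature.Topology.FourManifolds (SurfaceGroup)

/-! ### §0. Generic forms of Lemma 1.3.8 used below -/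

section Generic

variable {E F : FundamentalExtension.{0}}

/-- **[AbsAnab] Lemma 1.3.8, NF bases — generic**: if `Δ_E`, `Δ_F` are topologically finitely generated and the
bases are number fields, EVERY isomorphism of profinite groups `α : Π_E ⥲ Π_F` carries `Δ_E` onto `Δ_F`
([AbsAnab] Lemma 1.1.4 (i): `Δ` is the maximal t.f.g. closed normal subgroup; abc-iut's unconditional
`AbsTopII.rmk_3_3_2_NF_holds`). [cite: MochizukiAbsAnab2004, Lemma 1.3.8 p.18] -/
theorem NFBase.preservesGeom_of_geomTFG (BE : E.NFBase) (BF : F.NFBase) (hE : E.GeomTFG) (hF : F.GeomTFG)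
    (α : E.arith ≃ₜ* F.arith) : PreservesGeom α :=
  AbsTopII.rmk_3_3_2_NF_holds E ⟨⟨BE⟩, hE⟩ F ⟨⟨BF⟩, hF⟩ α

/-- **[AbsAnab] Lemma 1.3.8, MLF bases, `Σ = 𝔓𝔯𝔦𝔪𝔢𝔰` — generic, modulo print's inputs**: with both extensions
split over an open subgroup (F-0011), `Δ` t.f.g. and (∗) (F-0012), every `α : Π_E ⥲ Π_F` preserves `Δ`
(abc-iut-L4-t4's `preservesGeom_of_starCondition`, via [AbsTopI] Thm 2.6 (v)). Recorded here only to fix the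
by-name shape used in §2 (c). [cite: MochizukiAbsAnab2004, Lemma 1.3.8 p.18] -/
theorem MLFBase.preservesGeom_of_geomTFG_of_starCondition (BE : E.MLFBase) (BF : F.MLFBase)
    (hsE : E.SplitsOverOpenSubgroup) (hE : E.GeomTFG) (hstarE : E.StarCondition)
    (hsF : F.SplitsOverOpenSubgroup) (hF : F.GeomTFG) (hstarF : F.StarCondition)
    (α : E.arith ≃ₜ* F.arith) : PreservesGeom α :=
  preservesGeom_of_starCondition BE BF hsE hE hstarE hsF hF hstarF α

end Generic

/-! ### §1–§2, proper case: `Γ ≅ S_g`, `g ≥ 2` -/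

section Proper

variable {E F : FundamentalExtension.{0}} {Sigma Sigma' : Set ℕ} {Γ : Type} [Group Γ]
  {P : Type} [Group P] [TopologicalSpace P] [IsTopologicalGroup P] [CompactSpace P]
  [TotallyDisconnectedSpace P] {j : Γ →* P} {π : P →* E.geom} {U : Subgroup P}

/-- **[AbsAnab] Lemma 1.3.1 at the GFG construction (proper case), MLF base**: `Δ` and `Π` are slim.
[cite: MochizukiAbsAnab2004, Lemma 1.3.1 p.15] -/
theorem MLFBase.geomAndArithSlim_gfg (B : E.MLFBase) (hSS : Sigma ⊆ Sigma') (hS : ∃ ℓ ∈ Sigma, ℓ.Prime)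
    {g : ℕ} (hg : 2 ≤ g) (e : Γ ≃* SurfaceGroup g) (hj : IsProSigmaCompletion Sigma' j) [U.Normal]
    (hUo : IsOpen (U : Set P)) (hπc : Continuous π) (hπs : Function.Surjective π) (hker : π.ker ≤ U)
    (hmax : IsMaxProSigmaQuotient Sigma (π.subgroupMap U)) : E.GeomAndArithSlim :=
  B.geomAndArithSlim (geomSlimElastic_gfg hSS hS hg e hj hUo hπc hπs hker hmax).1

/-- **[AbsAnab] Lemma 1.3.1 at the GFG construction (proper case), NF base.**
[cite: MochizukiAbsAnab2004, Lemma 1.3.1 p.15] -/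
theorem NFBase.geomAndArithSlim_gfg (B : E.NFBase) (hSS : Sigma ⊆ Sigma') (hS : ∃ ℓ ∈ Sigma, ℓ.Prime)
    {g : ℕ} (hg : 2 ≤ g) (e : Γ ≃* SurfaceGroup g) (hj : IsProSigmaCompletion Sigma' j) [U.Normal]
    (hUo : IsOpen (U : Set P)) (hπc : Continuous π) (hπs : Function.Surjective π) (hker : π.ker ≤ U)
    (hmax : IsMaxProSigmaQuotient Sigma (π.subgroupMap U)) : E.GeomAndArithSlim :=
  B.geomAndArithSlim (geomSlimElastic_gfg hSS hS hg e hj hUo hπc hπs hker hmax).1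

/-- **[AbsAnab] Lemma 1.3.8 at the GFG construction (proper case), NF bases, any `Σ`**: for `E` whose `Δ` is the
Def 2.1 (i) quotient and ANY NF-based `F` with `Δ_F` t.f.g. (e.g. another GFG construction, by
`prop22_prop23_gfg_nf`), every `α : Π_E ⥲ Π_F` carries `Δ_E` onto `Δ_F`. [cite: MochizukiAbsAnab2004, Lemma 1.3.8 p.18] -/
theorem NFBase.preservesGeom_gfg (BE : E.NFBase) (hSS : Sigma ⊆ Sigma') (hS : ∃ ℓ ∈ Sigma, ℓ.Prime)
    (hSp : ∀ p ∈ Sigma, p.Prime) {g : ℕ} (hg : 2 ≤ g) (e : Γ ≃* SurfaceGroup g)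
    (hj : IsProSigmaCompletion Sigma' j) [U.Normal] (hUo : IsOpen (U : Set P)) (hπc : Continuous π)
    (hπs : Function.Surjective π) (hker : π.ker ≤ U) (hmax : IsMaxProSigmaQuotient Sigma (π.subgroupMap U))
    (BF : F.NFBase) (hF : F.GeomTFG) (α : E.arith ≃ₜ* F.arith) : PreservesGeom α :=
  NFBase.preservesGeom_of_geomTFG BE BF (prop22_prop23_gfg_nf BE hSS hS hSp hg e hj hUo hπc hπs hker hmax).1 hF α

/-- **[AbsAnab] Lemma 1.3.8 at the GFG construction (proper case), MLF bases, `Σ ⊊ 𝔓𝔯𝔦𝔪𝔢𝔰` — outright**: for `E`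
whose `Δ` is the Def 2.1 (i) quotient (hence almost pro-`Σ` and t.f.g.) and any MLF-based `F` with `Δ_F` t.f.g.
and almost pro-`T`, `T ⊊ 𝔓𝔯𝔦𝔪𝔢𝔰`, every `α : Π_E ⥲ Π_F` carries `Δ_E` onto `Δ_F` ([AbsTopI] Thm 2.6 (iv) on both
sides, `MLFBase.preservesGeom_of_isAlmostPro`). [cite: MochizukiAbsAnab2004, Lemma 1.3.8 p.18]
[cite: MochizukiAbsTopI2012, Thm 2.6 (iv) p.22] -/
theorem MLFBase.preservesGeom_gfg_of_isAlmostPro (BE : E.MLFBase) (hSS : Sigma ⊆ Sigma')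
    (hS : ∃ ℓ ∈ Sigma, ℓ.Prime) (hSp : ∀ p ∈ Sigma, p.Prime) (hSne : Sigma ≠ {q | q.Prime}) {g : ℕ}
    (hg : 2 ≤ g) (e : Γ ≃* SurfaceGroup g) (hj : IsProSigmaCompletion Sigma' j) [U.Normal]
    (hUo : IsOpen (U : Set P)) (hπc : Continuous π) (hπs : Function.Surjective π) (hker : π.ker ≤ U)
    (hmax : IsMaxProSigmaQuotient Sigma (π.subgroupMap U)) (BF : F.MLFBase) (hF : F.GeomTFG) {T : Set ℕ}
    (hT : T ⊆ {q | q.Prime}) (hTne : T ≠ {q | q.Prime}) (hFT : IsAlmostPro F.geom T)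
    (α : E.arith ≃ₜ* F.arith) : PreservesGeom α := by
  haveI : CompactSpace E.geom := isCompact_iff_compactSpace.mp E.isClosed_geom.isCompact
  exact MLFBase.preservesGeom_of_isAlmostPro BE BF
    (prop22_prop23_gfg_mlf BE hSS hS hSp hg e hj hUo hπc hπs hker hmax).1 hF (fun p hp => hSp p hp) hSne
    (GFGSurfaceModel.isAlmostPro hUo hπc hπs hker hmax) hT hTne hFT α

/-- **[AbsAnab] Lemma 1.3.8 at the GFG construction (proper case), MLF bases, `Σ = 𝔓𝔯𝔦𝔪𝔢𝔰` — modulo print's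
inputs**: `Δ_E` t.f.g. is DISCHARGED at the construction; the remaining binders are exactly [AbsAnab] Lemma 1.1.4
(ii)'s splitting (F-0011) and (∗) (F-0012) on both sides, and `Δ_F` t.f.g.
[cite: MochizukiAbsAnab2004, Lemma 1.3.8 p.18] -/
theorem MLFBase.preservesGeom_gfg_of_starCondition (BE : E.MLFBase) (hSS : Sigma ⊆ Sigma')
    (hS : ∃ ℓ ∈ Sigma, ℓ.Prime) (hSp : ∀ p ∈ Sigma, p.Prime) {g : ℕ} (hg : 2 ≤ g) (e : Γ ≃* SurfaceGroup g)
    (hj : IsProSigmaCompletion Sigma' j) [U.Normal] (hUo : IsOpen (U : Set P)) (hπc : Continuous π)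
    (hπs : Function.Surjective π) (hker : π.ker ≤ U) (hmax : IsMaxProSigmaQuotient Sigma (π.subgroupMap U))
    (hsE : E.SplitsOverOpenSubgroup) (hstarE : E.StarCondition) (BF : F.MLFBase)
    (hsF : F.SplitsOverOpenSubgroup) (hF : F.GeomTFG) (hstarF : F.StarCondition) (α : E.arith ≃ₜ* F.arith) :
    PreservesGeom α :=
  MLFBase.preservesGeom_of_geomTFG_of_starCondition BE BF hsE
    (prop22_prop23_gfg_mlf BE hSS hS hSp hg e hj hUo hπc hπs hker hmax).1 hstarE hsF hF hstarF α

end Proper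

/-! ### §1–§2, affine case: `Γ` free of rank `≥ 2` -/

section Affine

variable {E F : FundamentalExtension.{0}} {Sigma Sigma' : Set ℕ} {Γ : Type} [Group Γ] [IsFreeGroup Γ]
  [Finite (IsFreeGroup.Generators Γ)]
  {P : Type} [Group P] [TopologicalSpace P] [IsTopologicalGroup P] [CompactSpace P]
  [TotallyDisconnectedSpace P] {j : Γ →* P} {π : P →* E.geom} {U : Subgroup P}

/-- **[AbsAnab] Lemma 1.3.1 at the affine GFG construction, MLF base.** [cite: MochizukiAbsAnab2004, Lemma 1.3.1 p.15] -/
theorem MLFBase.geomAndArithSlim_gfg_affine (B : E.MLFBase) (hn : 2 ≤ Nat.card (IsFreeGroup.Generators Γ))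
    (hSS : Sigma ⊆ Sigma') (hS : ∃ ℓ ∈ Sigma, ℓ.Prime) (hj : IsProSigmaCompletion Sigma' j) [U.Normal]
    (hUo : IsOpen (U : Set P)) (hπc : Continuous π) (hπs : Function.Surjective π) (hker : π.ker ≤ U)
    (hmax : IsMaxProSigmaQuotient Sigma (π.subgroupMap U)) : E.GeomAndArithSlim :=
  B.geomAndArithSlim (geomSlimElastic_gfg_affine hn hSS hS hj hUo hπc hπs hker hmax).1

/-- **[AbsAnab] Lemma 1.3.1 at the affine GFG construction, NF base.** [cite: MochizukiAbsAnab2004, Lemma 1.3.1 p.15] -/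
theorem NFBase.geomAndArithSlim_gfg_affine (B : E.NFBase) (hn : 2 ≤ Nat.card (IsFreeGroup.Generators Γ))
    (hSS : Sigma ⊆ Sigma') (hS : ∃ ℓ ∈ Sigma, ℓ.Prime) (hj : IsProSigmaCompletion Sigma' j) [U.Normal]
    (hUo : IsOpen (U : Set P)) (hπc : Continuous π) (hπs : Function.Surjective π) (hker : π.ker ≤ U)
    (hmax : IsMaxProSigmaQuotient Sigma (π.subgroupMap U)) : E.GeomAndArithSlim :=
  B.geomAndArithSlim (geomSlimElastic_gfg_affine hn hSS hS hj hUo hπc hπs hker hmax).1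

/-- **[AbsAnab] Lemma 1.3.8 at the affine GFG construction, NF bases, any `Σ`.**
[cite: MochizukiAbsAnab2004, Lemma 1.3.8 p.18] -/
theorem NFBase.preservesGeom_gfg_affine (BE : E.NFBase) (hn : 2 ≤ Nat.card (IsFreeGroup.Generators Γ))
    (hSS : Sigma ⊆ Sigma') (hS : ∃ ℓ ∈ Sigma, ℓ.Prime) (hSp : ∀ p ∈ Sigma, p.Prime)
    (hj : IsProSigmaCompletion Sigma' j) [U.Normal] (hUo : IsOpen (U : Set P)) (hπc : Continuous π)
    (hπs : Function.Surjective π) (hker : π.ker ≤ U) (hmax : IsMaxProSigmaQuotient Sigma (π.subgroupMap U))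
    (BF : F.NFBase) (hF : F.GeomTFG) (α : E.arith ≃ₜ* F.arith) : PreservesGeom α :=
  NFBase.preservesGeom_of_geomTFG BE BF
    (prop22_prop23_gfg_affine_nf BE hn hSS hS hSp hj hUo hπc hπs hker hmax).1 hF α

/-- **[AbsAnab] Lemma 1.3.8 at the affine GFG construction, MLF bases, `Σ ⊊ 𝔓𝔯𝔦𝔪𝔢𝔰` — outright.**
[cite: MochizukiAbsAnab2004, Lemma 1.3.8 p.18] [cite: MochizukiAbsTopI2012, Thm 2.6 (iv) p.22] -/
theorem MLFBase.preservesGeom_gfg_affine_of_isAlmostPro (BE : E.MLFBase)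
    (hn : 2 ≤ Nat.card (IsFreeGroup.Generators Γ)) (hSS : Sigma ⊆ Sigma') (hS : ∃ ℓ ∈ Sigma, ℓ.Prime)
    (hSp : ∀ p ∈ Sigma, p.Prime) (hSne : Sigma ≠ {q | q.Prime}) (hj : IsProSigmaCompletion Sigma' j) [U.Normal]
    (hUo : IsOpen (U : Set P)) (hπc : Continuous π) (hπs : Function.Surjective π) (hker : π.ker ≤ U)
    (hmax : IsMaxProSigmaQuotient Sigma (π.subgroupMap U)) (BF : F.MLFBase) (hF : F.GeomTFG) {T : Set ℕ}
    (hT : T ⊆ {q | q.Prime}) (hTne : T ≠ {q | q.Prime}) (hFT : IsAlmostPro F.geom T)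
    (α : E.arith ≃ₜ* F.arith) : PreservesGeom α := by
  haveI : CompactSpace E.geom := isCompact_iff_compactSpace.mp E.isClosed_geom.isCompact
  exact MLFBase.preservesGeom_of_isAlmostPro BE BF
    (prop22_prop23_gfg_affine_mlf BE hn hSS hS hSp hj hUo hπc hπs hker hmax).1 hF (fun p hp => hSp p hp) hSne
    (GFGSurfaceModel.isAlmostPro hUo hπc hπs hker hmax) hT hTne hFT α

end Affine

/-! ### §1–§2 for the punctured surface groups `Γ_{g,k+1}` (every hyperbolic affine type) -/

section Punctured

variable {E F : FundamentalExtension.{0}} {Sigma Sigma' : Set ℕ} {g k : ℕ}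
  {P : Type} [Group P] [TopologicalSpace P] [IsTopologicalGroup P] [CompactSpace P]
  [TotallyDisconnectedSpace P] {j : PuncturedSurfaceGroup g (k + 1) →* P} {π : P →* E.geom} {U : Subgroup P}

/-- **[AbsAnab] Lemma 1.3.1 at the GFG construction over `Γ_{g,k+1}`, MLF base.**
[cite: MochizukiAbsAnab2004, Lemma 1.3.1 p.15] -/
theorem MLFBase.geomAndArithSlim_gfg_puncturedSurfaceGroup (B : E.MLFBase)
    (hgk : PuncturedSurfaceGroup.IsHyperbolicType g (k + 1)) (hSS : Sigma ⊆ Sigma') (hS : ∃ ℓ ∈ Sigma, ℓ.Prime)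
    (hj : IsProSigmaCompletion Sigma' j) [U.Normal] (hUo : IsOpen (U : Set P)) (hπc : Continuous π)
    (hπs : Function.Surjective π) (hker : π.ker ≤ U) (hmax : IsMaxProSigmaQuotient Sigma (π.subgroupMap U)) :
    E.GeomAndArithSlim :=
  B.geomAndArithSlim (geomSlimElastic_gfg_puncturedSurfaceGroup hgk hSS hS hj hUo hπc hπs hker hmax).1

/-- **[AbsAnab] Lemma 1.3.1 at the GFG construction over `Γ_{g,k+1}`, NF base.**
[cite: MochizukiAbsAnab2004, Lemma 1.3.1 p.15] -/
theorem NFBase.geomAndArithSlim_gfg_puncturedSurfaceGroup (B : E.NFBase)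
    (hgk : PuncturedSurfaceGroup.IsHyperbolicType g (k + 1)) (hSS : Sigma ⊆ Sigma') (hS : ∃ ℓ ∈ Sigma, ℓ.Prime)
    (hj : IsProSigmaCompletion Sigma' j) [U.Normal] (hUo : IsOpen (U : Set P)) (hπc : Continuous π)
    (hπs : Function.Surjective π) (hker : π.ker ≤ U) (hmax : IsMaxProSigmaQuotient Sigma (π.subgroupMap U)) :
    E.GeomAndArithSlim :=
  B.geomAndArithSlim (geomSlimElastic_gfg_puncturedSurfaceGroup hgk hSS hS hj hUo hπc hπs hker hmax).1

/-- **[AbsAnab] Lemma 1.3.8 at the GFG construction over `Γ_{g,k+1}`, NF bases, any `Σ`.**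
[cite: MochizukiAbsAnab2004, Lemma 1.3.8 p.18] -/
theorem NFBase.preservesGeom_gfg_puncturedSurfaceGroup (BE : E.NFBase)
    (hgk : PuncturedSurfaceGroup.IsHyperbolicType g (k + 1)) (hSS : Sigma ⊆ Sigma') (hS : ∃ ℓ ∈ Sigma, ℓ.Prime)
    (hSp : ∀ p ∈ Sigma, p.Prime) (hj : IsProSigmaCompletion Sigma' j) [U.Normal] (hUo : IsOpen (U : Set P))
    (hπc : Continuous π) (hπs : Function.Surjective π) (hker : π.ker ≤ U)
    (hmax : IsMaxProSigmaQuotient Sigma (π.subgroupMap U)) (BF : F.NFBase) (hF : F.GeomTFG)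
    (α : E.arith ≃ₜ* F.arith) : PreservesGeom α :=
  NFBase.preservesGeom_of_geomTFG BE BF
    (prop22_prop23_gfg_puncturedSurfaceGroup_nf BE hgk hSS hS hSp hj hUo hπc hπs hker hmax).1 hF α

/-- **[AbsAnab] Lemma 1.3.8 at the GFG construction over `Γ_{g,k+1}`, MLF bases, `Σ ⊊ 𝔓𝔯𝔦𝔪𝔢𝔰` — outright.**
[cite: MochizukiAbsAnab2004, Lemma 1.3.8 p.18] [cite: MochizukiAbsTopI2012, Thm 2.6 (iv) p.22] -/
theorem MLFBase.preservesGeom_gfg_puncturedSurfaceGroup_of_isAlmostPro (BE : E.MLFBase)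
    (hgk : PuncturedSurfaceGroup.IsHyperbolicType g (k + 1)) (hSS : Sigma ⊆ Sigma') (hS : ∃ ℓ ∈ Sigma, ℓ.Prime)
    (hSp : ∀ p ∈ Sigma, p.Prime) (hSne : Sigma ≠ {q | q.Prime}) (hj : IsProSigmaCompletion Sigma' j) [U.Normal]
    (hUo : IsOpen (U : Set P)) (hπc : Continuous π) (hπs : Function.Surjective π) (hker : π.ker ≤ U)
    (hmax : IsMaxProSigmaQuotient Sigma (π.subgroupMap U)) (BF : F.MLFBase) (hF : F.GeomTFG) {T : Set ℕ}
    (hT : T ⊆ {q | q.Prime}) (hTne : T ≠ {q | q.Prime}) (hFT : IsAlmostPro F.geom T)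
    (α : E.arith ≃ₜ* F.arith) : PreservesGeom α := by
  haveI : CompactSpace E.geom := isCompact_iff_compactSpace.mp E.isClosed_geom.isCompact
  exact MLFBase.preservesGeom_of_isAlmostPro BE BF
    (prop22_prop23_gfg_puncturedSurfaceGroup_mlf BE hgk hSS hS hSp hj hUo hπc hπs hker hmax).1 hF
    (fun p hp => hSp p hp) hSne (GFGSurfaceModel.isAlmostPro hUo hπc hπs hker hmax) hT hTne hFT α

/-- **[AbsAnab] Lemma 1.3.8 at the GFG construction over `Γ_{g,k+1}`, MLF bases, `Σ = 𝔓𝔯𝔦𝔪𝔢𝔰` — modulo print's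
[AbsAnab] Lemma 1.1.4 (ii) inputs** (splitting F-0011, (∗) F-0012 on both sides; `Δ_E` t.f.g. discharged).
[cite: MochizukiAbsAnab2004, Lemma 1.3.8 p.18] -/
theorem MLFBase.preservesGeom_gfg_puncturedSurfaceGroup_of_starCondition (BE : E.MLFBase)
    (hgk : PuncturedSurfaceGroup.IsHyperbolicType g (k + 1)) (hSS : Sigma ⊆ Sigma') (hS : ∃ ℓ ∈ Sigma, ℓ.Prime)
    (hSp : ∀ p ∈ Sigma, p.Prime) (hj : IsProSigmaCompletion Sigma' j) [U.Normal] (hUo : IsOpen (U : Set P))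
    (hπc : Continuous π) (hπs : Function.Surjective π) (hker : π.ker ≤ U)
    (hmax : IsMaxProSigmaQuotient Sigma (π.subgroupMap U)) (hsE : E.SplitsOverOpenSubgroup)
    (hstarE : E.StarCondition) (BF : F.MLFBase) (hsF : F.SplitsOverOpenSubgroup) (hF : F.GeomTFG)
    (hstarF : F.StarCondition) (α : E.arith ≃ₜ* F.arith) : PreservesGeom α :=
  MLFBase.preservesGeom_of_geomTFG_of_starCondition BE BF hsE
    (prop22_prop23_gfg_puncturedSurfaceGroup_mlf BE hgk hSS hS hSp hj hUo hπc hπs hker hmax).1 hstarE hsF hF hstarF α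

end Punctured

end FundamentalExtension

end Literature.AnabelianGeometry.AbsoluteAnabelian

end
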